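import Literature.NumberTheory.LFunctions.Zhang2022.RepairSection18Closed

/-!
# Zhang (2022), repair rung F-S1R, K-S2 (first half): the `O(1)` part of the `𝔠₃` slot is
# "formula II" on the design data — `−i(3𝔢′₁ + 3𝔢′₂ + 𝔢′₃ + 𝔢₀)` as a bilinear expression in
# `(g₁(0), ∫g₁; g₂(0), ∫g₂)`

Y. Zhang, *Discrete mean estimates and the Landau–Siegel zero*, arXiv:2211.02515v1 (2022)
[Zhang2022LandauSiegel] — an unrefereed manuscript under adjudication; nothing here is a claim about
its Theorems 1–2. Cell ruling R3 (D2a) makes the class functional of record for the `𝔠₃` slot the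
EXACT bilinear main term `P(g₁, R̃g₂)` of the cross term between the `H₁`-profile
`g₁ = ϰ(ν₁,k₁) + ι₂ϰ(ν₂,k₂)` and the reflected `H₂`-profile `g₂ = ῑ₃ϰ(ν₃,k₃) + ῑ₄ϰ(ν₂,k₂)`
(`ϰ(ν,k)(y) = (1 − y/ν)e^{iπk(ν−y)}` on `[0,ν]`, (2.23)–(2.25); audit dictionary
`pub-zhang/STRUCTURE.md` §3 "formula II", derivation map `repair/theory/KS2-DERIVATION.md` §§B, D).
The polar form `P = (s(u,v) + conj s(v,u))/2` of the tree's `mainTermFormSesq` has three kinds of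
terms: local integrals of products (they see only the OVERLAP windows `[1−ν₂, ν₁]`, `[1−ν₃, ν₁]` of
the two supports), the primitive term `−48π²i⟨u, S_v⟩` and the boundary terms
`−24π conj(∫v)(u(0)+u(1)) − 16i u(0)conj(v(1))`. With `u = g₁` (so `u(1) = 0`), `v = R̃g₂` (so
`v(0) = 0`, `v(1) = conj g₂(0)`, `∫v = conj ∫g₂`, and `S_u ≡ ∫g₁` on the support of `v` above `ν₁`)
the boundary/primitive part is the bilinear expression

`F₀(θ) = −8i·a₀b₀ − 12π(a₀I_b + I_a b₀) + 24π²i·I_aI_b`, `a₀ = g₁(0)`, `b₀ = g₂(0)`, `I_a = ∫g₁`,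
`I_b = ∫g₂` (the glued reading of STRUCTURE's `F0(a,b) = −i[Σ_j W′_j e_j(a)e_j(b) + a(0)b(0)]`,
`e_j(g) = g(0⁺) − iπj∫g`, `W′ = (3,3,1)`: `ΣW′_j + 1 = 8`, `ΣW′_j·j = 12`, `ΣW′_j·j² = 24`).

This file types that expression over `θ` from CLOSED-FORM data (no profile functions yet — those
come with the pair-block dictionary's `ϰ`): `kappaInt ν k = ∫₀^ν ϰ(ν,k) = (zExpPrim k ν − zExpPrim k 0)/ν`,
`a0T, b0T, IaT, IbT`, `F0part`, and proves

* `eR_eq_vk_sub_kappaInt` — the generic Lemma 15.1 closed form IS formula II's functional on a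
  `ϰ`-piece: `e(ν,k;j) = ϰ(0) − iπj∫ϰ = vkR ν k − iπj·kappaInt ν k` (`ν, k ≠ 0`);
* `eFun_side1`, `eFun_side2` — hence `e′_{1j} + ι₂e_{2j} = a₀ − iπjI_a`, `ῑ₃e_{3j} + ῑ₄e_{2j} = b₀ − iπjI_b`;
* **`F0part_eq`** — `F₀(θ) = frakc3rT θ − 2·e2starT θ = −i(3𝔢′₁ + 3𝔢′₂ + 𝔢′₃ + 𝔢₀)(θ)` for every
  `θ` with non-zero lengths and shifts: the manuscript's Lemma 15.1 / (17.4) / (18.1) block IS the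
  `O(1)` part of the exact bilinear cross term, identically in `θ`; what the transcribed reduced form
  `frakc3rT` adds to it is `2e₂*`, the manuscript's LINEARISED evaluation ((12.13)–(12.17)) of the
  window part — so the K-S2 discrepancy of record is `frakc3S − frakc3rT = (window part) − 2e₂*`
  (`2.2·10⁻⁶` at `θ₀`, audit dictionary validation), typed in the companion `RepairFrakc3S`.

Algebra over the closed forms of `RepairSection18Closed`; no analytic content, no `Prop` facts.
-/

noncomputable section

open Complex Real ComplexConjugate

namespace Literature.NumberTheory.LFunctions.Zhang2022

namespace Repair

/-! ### The integral of a `ϰ`-piece and the formula-II functional on it -/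

/-- `∫₀^ν ϰ(ν,k) = ∫₀^ν (1 − y/ν)e^{iπk(ν−y)} dy = (1/ν)∫₀^ν u e^{kπiu} du` in closed form
(`u = ν − y`; `k ≠ 0`). [cite: Zhang2022LandauSiegel, (2.23)–(2.25), Lemma 15.1] -/
def kappaInt (ν k : ℝ) : ℂ := (zExpPrim k ν - zExpPrim k 0) / (ν : ℂ)

/-- `kappaInt ν k = (1/ν)∫₀^ν u e^{kπiu} du` (`k ≠ 0`). [cite: Zhang2022LandauSiegel, Lemma 15.1, Appendix B] -/
theorem kappaInt_eq_integral {k : ℝ} (hk : k ≠ 0) (ν : ℝ) :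
    kappaInt ν k = (∫ u in (0:ℝ)..ν, (u : ℂ) * cexp ((k : ℂ) * π * I * u)) / (ν : ℂ) := by
  unfold kappaInt; rw [integral_z_cexp_kpi hk]

/-- `∫₀^ν (1 − y/ν)e^{iπk(ν−y)} dy = kappaInt ν k` — the `ϰ`-piece integral in the manuscript's variable
(`ν, k ≠ 0`). [cite: Zhang2022LandauSiegel, (2.23)–(2.25), Lemma 15.1] -/
theorem integral_kappa_shape {ν k : ℝ} (hν : ν ≠ 0) (hk : k ≠ 0) :
    ∫ y in (0:ℝ)..ν, (1 - (y : ℂ) / ν) * cexp (I * π * k * ((ν : ℂ) - y)) = kappaInt ν k := by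
  have hν' : (ν : ℂ) ≠ 0 := by exact_mod_cast hν
  rw [kappaInt_eq_integral hk, ← intervalIntegral.integral_div]
  have e : (fun y : ℝ => (1 - (y : ℂ) / ν) * cexp (I * π * k * ((ν : ℂ) - y)))
      = fun y : ℝ => (fun u : ℝ => (u : ℂ) * cexp ((k : ℂ) * π * I * u) / ν) (ν - y) := by
    funext y
    have : (((ν - y : ℝ)) : ℂ) / ν = 1 - (y : ℂ) / ν := by push_cast; field_simp
    simp only []
    rw [← this]
    push_cast
    field_simp
  rw [e, intervalIntegral.integral_comp_sub_left (fun u : ℝ => (u : ℂ) * cexp ((k : ℂ) * π * I * u) / ν) ν,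
    sub_self, sub_zero]

/-- **The Lemma 15.1 closed form is formula II's functional `e_j(g) = g(0⁺) − iπj∫g` on a `ϰ`-piece**:
`e(ν,k;j) = e^{iπkν} − iπj·kappaInt ν k` (`ν, k ≠ 0`). [cite: Zhang2022LandauSiegel, Lemma 15.1, Appendix B] -/
theorem eR_eq_vk_sub_kappaInt {ν k : ℝ} (hν : ν ≠ 0) (hk : k ≠ 0) (j : ℕ) :
    eR ν k j = vkR ν k - I * π * j * kappaInt ν k := by
  unfold eR vkR kappaInt zExpPrim
  have hk' : (k : ℂ) ≠ 0 := by exact_mod_cast hk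
  have hν' : (ν : ℂ) ≠ 0 := by exact_mod_cast hν
  have hπ : (π : ℂ) ≠ 0 := by exact_mod_cast Real.pi_ne_zero
  have hI : I ≠ 0 := I_ne_zero
  have e : cexp ((ν : ℂ) * k * π * I) = cexp ((k : ℂ) * π * I * ν) := by congr 1; ring
  rw [e]
  simp only [Complex.ofReal_zero, mul_zero, Complex.exp_zero, mul_one, zero_div, zero_sub]
  field_simp
  ring

/-! ### The design data `a₀, b₀, I_a, I_b` and the formula-II block -/

/-- `a₀(θ) = g₁(0⁺) = ϰ₁(1) + ι₂ϰ₂(1) = e^{iπk₁ν₁} + ι₂e^{iπk₂ν₂}` ((17.4), first factor of `𝔢₀`).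
[cite: Zhang2022LandauSiegel, (17.4)] -/
def a0T (θ : Theta) : ℂ := vk1T θ + θ.iota2 * vk2T θ

/-- `b₀(θ) = g₂(0⁺) = ῑ₃ϰ₃(1) + ῑ₄ϰ₂(1)` ((17.4), second factor of `𝔢₀`; `ϰ₄ := ϰ₂`).
[cite: Zhang2022LandauSiegel, (17.4)] -/
def b0T (θ : Theta) : ℂ := conj θ.iota3 * vk3T θ + conj θ.iota4 * vk2T θ

/-- `I_a(θ) = ∫g₁ = kappaInt ν₁ k₁ + ι₂·kappaInt ν₂ k₂`. [cite: Zhang2022LandauSiegel, (2.23)–(2.24), (2.27)] -/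
def IaT (θ : Theta) : ℂ := kappaInt θ.nu1 θ.k1 + θ.iota2 * kappaInt θ.nu2 θ.k2

/-- `I_b(θ) = ∫g₂ = ῑ₃·kappaInt ν₃ k₃ + ῑ₄·kappaInt ν₂ k₂`. [cite: Zhang2022LandauSiegel, (2.24)–(2.25), (2.27)] -/
def IbT (θ : Theta) : ℂ := conj θ.iota3 * kappaInt θ.nu3 θ.k3 + conj θ.iota4 * kappaInt θ.nu2 θ.k2

/-- `e′_{1j} + ι₂e_{2j} = a₀ − iπj·I_a` (formula II's `e_j` on the `H₁`-profile; non-zero lengths/shifts).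
[cite: Zhang2022LandauSiegel, Lemma 15.1] -/
theorem eFun_side1 (θ : Theta) (hν1 : θ.nu1 ≠ 0) (hν2 : θ.nu2 ≠ 0) (hk1 : θ.k1 ≠ 0) (hk2 : θ.k2 ≠ 0)
    (j : ℕ) : e1pT θ j + θ.iota2 * e2T θ j = a0T θ - I * π * j * IaT θ := by
  unfold e1pT e2T a0T IaT vk1T vk2T
  rw [eR_eq_vk_sub_kappaInt hν1 hk1, eR_eq_vk_sub_kappaInt hν2 hk2]
  ring

/-- `ῑ₃e_{3j} + ῑ₄e_{2j} = b₀ − iπj·I_b` (formula II's `e_j` on the `H₂`-profile; non-zero lengths/shifts).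
[cite: Zhang2022LandauSiegel, Lemma 15.1] -/
theorem eFun_side2 (θ : Theta) (hν2 : θ.nu2 ≠ 0) (hν3 : θ.nu3 ≠ 0) (hk2 : θ.k2 ≠ 0) (hk3 : θ.k3 ≠ 0)
    (j : ℕ) : conj θ.iota3 * e3T θ j + conj θ.iota4 * e2T θ j = b0T θ - I * π * j * IbT θ := by
  unfold e3T e2T b0T IbT vk3T vk2T
  rw [eR_eq_vk_sub_kappaInt hν3 hk3, eR_eq_vk_sub_kappaInt hν2 hk2]
  ring

/-- `𝔢₀(θ) = a₀(θ)·b₀(θ)` ((17.4) is the product of the two profiles' values at `n = 1`).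
[cite: Zhang2022LandauSiegel, (17.4)] -/
theorem frake0T_eq (θ : Theta) : frake0T θ = a0T θ * b0T θ := by
  unfold frake0T a0T b0T vk4T; ring

/-- `𝔢′_j(θ) = (a₀ − iπjI_a)(b₀ − iπjI_b)` (Lemma 15.1's product structure through formula II's functional).
[cite: Zhang2022LandauSiegel, Lemma 15.1, §18 before (18.2)] -/
theorem frakepT_eq (θ : Theta) (hν1 : θ.nu1 ≠ 0) (hν2 : θ.nu2 ≠ 0) (hν3 : θ.nu3 ≠ 0)
    (hk1 : θ.k1 ≠ 0) (hk2 : θ.k2 ≠ 0) (hk3 : θ.k3 ≠ 0) (j : ℕ) :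
    frakepT θ j = (a0T θ - I * π * j * IaT θ) * (b0T θ - I * π * j * IbT θ) := by
  unfold frakepT
  rw [eFun_side1 θ hν1 hν2 hk1 hk2, eFun_side2 θ hν2 hν3 hk2 hk3]

/-- **The formula-II block** `F₀(θ) = −8i·a₀b₀ − 12π(a₀I_b + I_a b₀) + 24π²i·I_aI_b`: the
boundary/primitive part of the exact bilinear cross term `P(g₁, R̃g₂)` (STRUCTURE §3 `F0` with the
full `∫g₁`; coefficients `ΣW′_j + 1 = 8`, `ΣW′_j j = 12`, `ΣW′_j j² = 24`, `W′ = (3,3,1)`).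
[cite: Zhang2022LandauSiegel, §18 (18.1), Lemma 15.1, (17.4)] -/
def F0part (θ : Theta) : ℂ :=
  -8 * I * (a0T θ * b0T θ) - 12 * π * (a0T θ * IbT θ + IaT θ * b0T θ) + 24 * π ^ 2 * I * (IaT θ * IbT θ)

/-- `F₀ = −i[Σ_j W′_j (a₀ − iπjI_a)(b₀ − iπjI_b) + a₀b₀]`, `W′ = (3,3,1)` (the coefficient bookkeeping).
[cite: Zhang2022LandauSiegel, §18 (18.1)] -/
theorem F0part_eq_weights (θ : Theta) :
    F0part θ = -I * (3 * ((a0T θ - I * π * 1 * IaT θ) * (b0T θ - I * π * 1 * IbT θ))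
      + 3 * ((a0T θ - I * π * 2 * IaT θ) * (b0T θ - I * π * 2 * IbT θ))
      + ((a0T θ - I * π * 3 * IaT θ) * (b0T θ - I * π * 3 * IbT θ)) + a0T θ * b0T θ) := by
  unfold F0part
  linear_combination (-12 * (π : ℂ) * (a0T θ * IbT θ + IaT θ * b0T θ)
    + 24 * (π : ℂ) ^ 2 * I * (IaT θ * IbT θ)) * Complex.I_sq

/-- **K-S2, `O(1)` part: the manuscript's `−i(3𝔢′₁ + 3𝔢′₂ + 𝔢′₃ + 𝔢₀)` IS the formula-II block**, for
every `θ` with non-zero lengths and shifts: `F0part θ = frakc3rT θ − 2·e2starT θ`. Consequently the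
transcribed reduced `𝔠₃` differs from the exact bilinear cross term exactly by
`(window part) − 2e₂*`. [cite: Zhang2022LandauSiegel, §18 (18.1)–(18.2)] -/
theorem F0part_eq (θ : Theta) (hν1 : θ.nu1 ≠ 0) (hν2 : θ.nu2 ≠ 0) (hν3 : θ.nu3 ≠ 0)
    (hk1 : θ.k1 ≠ 0) (hk2 : θ.k2 ≠ 0) (hk3 : θ.k3 ≠ 0) :
    F0part θ = frakc3rT θ - 2 * e2starT θ := by
  rw [F0part_eq_weights]
  unfold frakc3rT
  rw [frakepT_eq θ hν1 hν2 hν3 hk1 hk2 hk3, frakepT_eq θ hν1 hν2 hν3 hk1 hk2 hk3,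
    frakepT_eq θ hν1 hν2 hν3 hk1 hk2 hk3, frake0T_eq]
  push_cast
  ring

/-- The same for the derived-`e″` form: `frakc3DT θ − 2·e2starT θ − identResidualDT θ = F0part θ`.
[cite: Zhang2022LandauSiegel, §18 (18.1)–(18.2)] -/
theorem F0part_eq_D (θ : Theta) (hν1 : θ.nu1 ≠ 0) (hν2 : θ.nu2 ≠ 0) (hν3 : θ.nu3 ≠ 0)
    (hk1 : θ.k1 ≠ 0) (hk2 : θ.k2 ≠ 0) (hk3 : θ.k3 ≠ 0) :
    F0part θ = frakc3DT θ - identResidualDT θ - 2 * e2starT θ := by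
  rw [frakc3DT_eq_add, F0part_eq θ hν1 hν2 hν3 hk1 hk2 hk3]; ring

/-- At admissible-type points the hypotheses hold: on the printed `ι`-family `F₀ = frakc3rG − 2e2starG`.
[cite: Zhang2022LandauSiegel, §18 (18.1)–(18.2)] -/
theorem F0part_thetaIota (w2 w3 w4 : ℂ) :
    F0part (thetaIota w2 w3 w4) = frakc3rG w2 w3 w4 - 2 * e2starG w3 w4 := by
  rw [F0part_eq _ (by rw [thetaIota_nu1]; norm_num) (by rw [thetaIota_nu2]; norm_num)
    (by rw [thetaIota_nu3]; norm_num) (by rw [thetaIota_k1]; norm_num) (by rw [thetaIota_k2]; norm_num)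
    (by rw [thetaIota_k3]; norm_num), frakc3rT_thetaIota, e2starT_thetaIota]

end Repair

end Literature.NumberTheory.LFunctions.Zhang2022
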